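/- Copyright: the b2b-balaban cell (near-miss cell 7), T⁴-continuum CRUX team (coordinator ruling e34b3e0c item (2)), row NE7b,
lineage t4-ne7b-formalise-leaf-02 (gen 126; E-side ∕ key-readings lineage) — the PEDIGREE READING owed by `KeyPatternBooking`:
«a key's recorded births are booked», for the key family OF RECORD `kmemA`, and IR-104-2's row `pwA` from the step kernel's two
displays alone.  Released under the licence of the surrounding project. -/
import Summits.QuantumFields.BalabanUV.T4Continuum.Spine.NE7b.ClassPatternBooking
import Summits.QuantumFields.BalabanUV.T4Continuum.Support.HistoryGenealogyJunctionVDistinct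

/-!
# THE RECORDED BIRTHS OF THE KEY OF RECORD ARE BOOKED: `pwA` along the key pattern of `kmemA` from positivity and the
# field-support reading of the step kernel ALONE (row NE7b, node U5c; E-side bookkeeping, sequel of `KeyPatternBooking`)

Crux-route work under `Spine/NE7b/` of the T⁴-continuum cell (rung (B)+1 on a FINITE torus only; NOT infinite volume, NOT the mass
gap, NOT Clay; NOT a proof of NE7b — `T4WeightBudget.RelWeightBound`, the cell's OWN estimate, NOT PRINTED, NOT PROVED).  [folklore]
finite combinatorics over the TREE's own objects: the key family of record (`HistoryRealiseCellsRunAssemblyWTVSData.kmemA` =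
`HistoryAssemblyMultKey.kmemOf` at the pass-V pedigree `InputFamily.pedV`, live names `liveCV`, root cells `cellA` and the physical
datum of record `HistoryJoinsPlacedMult.physV`), pass V's «births are input regions» (`RunInputM.mem_N_of_mem_pbirths_pedMV`,
`HistoryGenealogyJunctionVDistinct`), and `KeyPatternBooking.pointwiseExtraction_keyPattern_of_reading` ∕
`ClassPatternBooking.pointwiseExtraction_classPattern_of_readingM`.  It types NO
`T4Continuum/Support` leaf, mints no `Prop`, carries no `[cite:]` tag, asserts nothing of Bałaban's; zero `sorry`.

WHY.  `KeyPatternBooking` inhabits IR-104-2's row `pwA` (`PointwiseExtraction` along `keyPattern`) from (d1) positivity ∕ `Σ_{pinned} χ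
≤ 1`, (d2) the field-support reading of the step kernel and (d3) a family `R (j + 1)` of regions — or of VALUES of regions under a
reading `v` — realised at level `j + 1` by EVERY term of the key's fibre, and names (d3)'s supplier: the PEDIGREE READING «a key's
recorded births at level `ℓ` are booked at level `ℓ` by every term of its fibre».  For the key family OF RECORD this is a theorem
of pass V: a key `w ∈ kmemA … K τ` is `keyOf … K τ c` of a live name `c = (K, c₀)`, `c₀ ∈ histV.comp K`, its datum `w.2.2 = physV … c`
lists the PHYSICAL BIRTHS `(e, Z)` of the dissolved genealogy `pedMV.toPGen id c` PLACED as `untypeV (valP … e Z)`, and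
`mem_N_of_mem_pbirths_pedMV` says `Z ∈ N (step e)` with `e = (step e, 0, cls Z)` — so every recorded birth value of the key at level
`ℓ` is the PLACED VALUE `placeV … K ℓ Z` of a region `Z` its term booked at level `ℓ`, under the six input displays the road's
records already carry (`NewOK` from `hν`, `Rm ≤ R`, `hRmS`, `hRm2`, `NewDisjoint`, `0 < L`).

WHAT.  §1 `birthVals k ℓ` (the recorded birth values of the key family `k` at level `ℓ`: the values `v` with `(e, v)` in some
member's datum, `step e = ℓ`; `mem_birthVals`) and `placeV n L hn hL M hM s cls K ℓ Z` (the placement reading of a region booked at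
level `ℓ` of run `K`: `untypeV (valP n L K _ (levelOf (s K) K) (M K) _ (ℓ, 0, cls Z) Z)` — `physV`'s value map at the label pass V
gives a birth).  §2 **`birthVals_kmemA_subset_image`** — THE PEDIGREE READING for ANY `HistReading`: under the six input displays of
the term's run, `birthVals (kmemA n L hn hL ℛ K τ) ℓ ⊆ ((ℛ.inputOf.run K τ).N ℓ).image (placeV … (ℛ.inputOf.run K τ).cls K ℓ)`.
`birthValsM` ∕ `mem_birthValsM` (the same WITH MULTIPLICITY: one entry per recorded birth, per member) and the re-indexing
**`sum_range_birthValsM`**: `Σ_{j<K} Σ_{w ∈ birthValsM k (j+1)} θ j w = Σ_{members w ∈ k} Σ_{births (e,v) of w, 1 ≤ step e ≤ K}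
θ (step e − 1) v` — the window's total extraction as a sum over the key's MEMBERS (the form a per-member ledger consumes).
§3 at the causal step reading `𝒮.reading T p₀` (`cls = 𝒮.κ K` on `termSet … K`, `cls_run_eq`): **`birthVals_subset_image_of_mem_fibre`**
((d3) of `KeyPatternBooking.pointwiseExtraction_keyPattern_of_reading` DISCHARGED for `R := birthVals k`, `v ℓ := placeV … (𝒮.κ K) K ℓ`)
and **`pointwiseExtraction_keyPattern_kmemA`**: for every key `k`, `PointwiseExtraction (T K) (keyPattern T p₀ (kmemA …) K k) K χ
(fun j _ y => exp (δ·Σ_{w ∈ birthVals k (j+1)} F j w y)) (fun j _ => δ·Σ_{w ∈ birthVals k (j+1)} θ j w)` from (d1) `hle1` (or positivity +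
`hunit`: **`pointwiseExtraction_keyPattern_kmemA_of_unit`**) and (d2) the field-support reading THROUGH THE PLACEMENT
(`χ K j g p y ≠ 0 → ∀ Z ∈ 𝒮.ν K j g p, θ j (placeV … K (j+1) Z) ≤ F j (placeV … K (j+1) Z) y`), plus the record's input displays —
NO (d3) binder left; **`pointwiseExtraction_keyPattern_kmemA_mult`** = the same with the exponent and the carrier summed over
`birthValsM` (per member, with multiplicity — the ledger's currency; `ClassPatternBooking.pointwiseExtraction_classPattern_of_readingM`).
So IR-104-2's `pwA` (whose key family IS `kmemA n F.L hn … (𝒮.reading T p₀)`) at an (A1c) instance reduces BY NAME to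
(d1) + (d2): two displays of print's kind about the instance's OWN step kernel ([Balaban1989LargeFieldI] (1.22)–(1.28) pp. 181–183 —
LOCATOR), with the extracted exponent `aA K k j = δ·Σ_{w ∈ birthVals k (j+1)} θ j w` — a sum over the key's RECORDED BIRTHS at the
level, the currency in which the window ledger `ledgerA` prices the key's members — and the carrier `MA K k t j _ y =
exp (δ·Σ_{w ∈ birthVals k (j+1)} F j w y)` NAMED for `lcsA`.

NOT HERE (honest).  (d1), (d2) and `lcsA` — (A1c)'s; the placement's faithfulness (a region is determined by its placed value under
`RegionsInBox` and the class cap — NOT needed here: (d2) is read through the placement, the instance choosing `F j w` as a functional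
of the PLACED value that DOMINATES its region functional on every region placing to `w`, e.g. a MAXIMUM over the anchors the placement
forgets — the multiplicity `#(placement fibre)` then moves into `lcsA`'s constant, chair leaf-03 g137 INFO-3); run B's twin
(`ClassPatternBooking` §4, whose (d3B) stays a display: `trunc` is abstract).  BY-NAME EFFECT ON THE WALL: NONE; nothing of Bałaban's is
discharged.  NE7b NOT PRINTED ∕ NOT PROVED; spine PROVED 0∕9.  HONEST DEPENDENCY (cell): continuum YM on T⁴ ⇐ BetaPertH
∧ nine spine estimates (0/9 proved); BetaPertH ⇐ (D1) ∧ (D4) ∧ CAP+tail; G-an2-4 gates asym, D1 and NE2/3/4.  This file changes none of it.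
-/

set_option autoImplicit false

open Finset Real
open Literature.MathematicalPhysics.QuantumFieldTheory.Balaban1983to89
open Literature.MathematicalPhysics.QuantumFieldTheory.Balaban1983to89.T4LiveClassFibration
open Literature.MathematicalPhysics.QuantumFieldTheory.Balaban1983to89.T4PersistenceDictionary
open Literature.MathematicalPhysics.QuantumFieldTheory.Balaban1983to89.B13ScaleTransfer
open Literature.MathematicalPhysics.QuantumFieldTheory.Balaban1983to89.TreeLength
open Summit.QuantumFields.BalabanUV.T4Continuum.HistoryGenealogyRealise (Lab)
open Summit.QuantumFields.BalabanUV.T4Continuum.HistoryZones (levelOf)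
open Summit.QuantumFields.BalabanUV.T4Continuum.HistoryCaps (dcapOf)
open Summit.QuantumFields.BalabanUV.T4Continuum.HistoryRegionTemplates (tcap one_le_tcap)
open Summit.QuantumFields.BalabanUV.T4Continuum.HistoryAssemblyRealiseRun (runProfile)
open Summit.QuantumFields.BalabanUV.T4Continuum.HistoryGenealogyInstantiate
open Summit.QuantumFields.BalabanUV.T4Continuum.HistoryAssemblyMultKey
open Summit.QuantumFields.BalabanUV.T4Continuum.HistoryAssemblyTerms
open Summit.QuantumFields.BalabanUV.T4Continuum.HistoryJoinsPlacedValue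
open Summit.QuantumFields.BalabanUV.T4Continuum.HistoryJoinsPlacedMult
open Summit.QuantumFields.BalabanUV.T4Continuum.HistoryRealiseCellsRunSupplyWTVS
open Summit.QuantumFields.BalabanUV.T4Continuum.HistoryRealiseCellsRunAssemblyWTVSData
open Summit.QuantumFields.BalabanUV.T4Continuum.B16HistoryIndexedRepr
open Summit.QuantumFields.BalabanUV.T4Continuum.B16HistoryReprChain
open Summit.QuantumFields.BalabanUV.T4Continuum.B16HistoryReprInstance
open Summit.QuantumFields.BalabanUV.T4Continuum.B16HistoryReprReadCausal
open Summit.QuantumFields.BalabanUV.T4Continuum.NE7b.PrefixExtraction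
open Summit.QuantumFields.BalabanUV.T4Continuum.NE7b.LocalConditionalStability
open Summit.QuantumFields.BalabanUV.T4Continuum.NE7b.KeyPatternReading
open Summit.QuantumFields.BalabanUV.T4Continuum.NE7b.KeyPatternBooking
open Summit.QuantumFields.BalabanUV.T4Continuum.NE7b.KeyPatternReadingB
open Summit.QuantumFields.BalabanUV.T4Continuum.NE7b.ClassPatternBooking

namespace Summit.QuantumFields.BalabanUV.T4Continuum.NE7b.KeyBirthsBooked

noncomputable section

set_option synthInstance.maxSize 1024

/-! ## §1 The recorded birth values of a key family at a level; the placement reading of a booked region -/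

section Data

variable {d : ℕ}

/-- **THE RECORDED BIRTH VALUES OF THE KEY FAMILY `k` AT LEVEL `ℓ`**: the placed values `v` such that `(e, v)` lies in the physical
datum of some member key of `k` with `step e = ℓ`.  Data read off the key alone.  (A `Finset`: births of distinct members with EQUAL
placed value at one level are booked once — no loss where the placement is faithful on booked regions, i.e. under the records'
`RegionsInBox` ∕ class-cap displays; not needed and not proved here.) [folklore] -/
def birthVals (k : Finset ((Fin d → ℕ) × Gen PEv × Multiset (PEv × ((Fin d → ℕ) × Finset (Pt d))))) (ℓ : ℕ) :
    Finset ((Fin d → ℕ) × Finset (Pt d)) :=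
  k.biUnion fun w => ((w.2.2.filter fun bv => bv.1.step = ℓ).map Prod.snd).toFinset

/-- membership in the recorded birth values. [folklore] -/
theorem mem_birthVals {k : Finset ((Fin d → ℕ) × Gen PEv × Multiset (PEv × ((Fin d → ℕ) × Finset (Pt d))))} {ℓ : ℕ}
    {v : (Fin d → ℕ) × Finset (Pt d)} :
    v ∈ birthVals k ℓ ↔ ∃ w ∈ k, ∃ e : PEv, (e, v) ∈ w.2.2 ∧ e.step = ℓ := by
  simp only [birthVals, Finset.mem_biUnion, Multiset.mem_toFinset, Multiset.mem_map, Multiset.mem_filter, Prod.exists,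
    exists_eq_right]

/-- **THE RECORDED BIRTHS OF THE KEY FAMILY AT LEVEL `ℓ`, WITH MULTIPLICITY**: the multiset sum over the member keys of their level-`ℓ`
birth values — one entry per recorded birth (the per-member currency of the window ledger `ledgerA`; no identification of equal values
across members). [folklore] -/
def birthValsM (k : Finset ((Fin d → ℕ) × Gen PEv × Multiset (PEv × ((Fin d → ℕ) × Finset (Pt d))))) (ℓ : ℕ) :
    Multiset ((Fin d → ℕ) × Finset (Pt d)) :=
  ∑ w ∈ k, (w.2.2.filter fun bv => bv.1.step = ℓ).map Prod.snd

/-- membership in the recorded births with multiplicity = membership in the recorded birth values. [folklore] -/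
theorem mem_birthValsM {k : Finset ((Fin d → ℕ) × Gen PEv × Multiset (PEv × ((Fin d → ℕ) × Finset (Pt d))))} {ℓ : ℕ}
    {v : (Fin d → ℕ) × Finset (Pt d)} :
    v ∈ birthValsM k ℓ ↔ ∃ w ∈ k, ∃ e : PEv, (e, v) ∈ w.2.2 ∧ e.step = ℓ := by
  simp only [birthValsM, Multiset.mem_sum, Multiset.mem_map, Multiset.mem_filter, Prod.exists, exists_eq_right]

/-- the support of the recorded births with multiplicity is the set of recorded birth values. [folklore] -/
theorem mem_birthValsM_iff_mem_birthVals {k : Finset ((Fin d → ℕ) × Gen PEv × Multiset (PEv × ((Fin d → ℕ) × Finset (Pt d))))}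
    {ℓ : ℕ} {v : (Fin d → ℕ) × Finset (Pt d)} : v ∈ birthValsM k ℓ ↔ v ∈ birthVals k ℓ := by
  rw [mem_birthValsM, mem_birthVals]

/-- re-indexing one member's datum: summing its level-`(j+1)` birth values over `j < K` is summing its births with `1 ≤ step ≤ K` at
`θ (step − 1)`. [folklore] -/
theorem sum_range_filter_step {V : Type*} (m : Multiset (PEv × V)) (θ : ℕ → V → ℝ) (K : ℕ) :
    ∑ j ∈ Finset.range K, ((m.filter fun bv => bv.1.step = j + 1).map fun bv => θ j bv.2).sum =
      ((m.filter fun bv => 1 ≤ bv.1.step ∧ bv.1.step ≤ K).map fun bv => θ (bv.1.step - 1) bv.2).sum := by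
  induction m using Multiset.induction_on with
  | empty => simp
  | cons a m ih =>
      simp only [Multiset.filter_cons, Multiset.map_add, Multiset.sum_add, Finset.sum_add_distrib, ih]
      congr 1
      by_cases h : 1 ≤ a.1.step ∧ a.1.step ≤ K
      · rw [if_pos h]
        have hmem : a.1.step - 1 ∈ Finset.range K := Finset.mem_range.2 (by omega)
        rw [Finset.sum_eq_single_of_mem (a.1.step - 1) hmem]
        · have : a.1.step = a.1.step - 1 + 1 := by omega
          rw [if_pos this]; simp
        · intro j _ hj
          rw [if_neg (by omega)]; simp
      · rw [if_neg h]
        simp only [Multiset.map_zero, Multiset.sum_zero]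
        refine Finset.sum_eq_zero fun j hj => ?_
        rw [if_neg (by have := Finset.mem_range.1 hj; omega)]; simp

/-- **THE WINDOW's TOTAL EXTRACTION IS A SUM OVER THE KEY's MEMBERS OF THEIR PER-BIRTH EXTRACTIONS** (levels `j + 1 ≤ K` ↔ recorded births
with `1 ≤ step ≤ K`, each at `θ (step − 1)`): the form in which a window ledger priced PER MEMBER (IR-104-2's `ledgerA`: a product over
`memA … K τ`) consumes the exponents `a j = δ·Σ_{w ∈ birthValsM k (j+1)} θ j w` of `pointwiseExtraction_keyPattern_kmemA_mult`. [folklore] -/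
theorem sum_range_birthValsM (k : Finset ((Fin d → ℕ) × Gen PEv × Multiset (PEv × ((Fin d → ℕ) × Finset (Pt d)))))
    (θ : ℕ → (Fin d → ℕ) × Finset (Pt d) → ℝ) (K : ℕ) :
    ∑ j ∈ Finset.range K, ((birthValsM k (j + 1)).map (θ j)).sum =
      ∑ w ∈ k, ((w.2.2.filter fun bv => 1 ≤ bv.1.step ∧ bv.1.step ≤ K).map fun bv => θ (bv.1.step - 1) bv.2).sum := by
  classical
  have e : ∀ j, ((birthValsM k (j + 1)).map (θ j)).sum =
      ∑ w ∈ k, ((w.2.2.filter fun bv => bv.1.step = j + 1).map fun bv => θ j bv.2).sum := by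
    intro j
    induction k using Finset.induction_on with
    | empty => simp [birthValsM]
    | insert w k hw ih =>
        rw [Finset.sum_insert hw, ← ih]
        simp only [birthValsM, Finset.sum_insert hw, Multiset.map_add, Multiset.sum_add, Multiset.map_map, Function.comp_def]
  simp_rw [e]
  rw [Finset.sum_comm]
  exact Finset.sum_congr rfl fun w _ => sum_range_filter_step w.2.2 θ K

/-- **THE PLACEMENT READING OF A REGION BOOKED AT LEVEL `ℓ` OF RUN `K`**: `physV`'s value of the birth `((ℓ, 0, cls Z), Z)` — the
corner cell of the anchor at the level of the step and the template «region − anchor», read cutoff-free (`untypeV ∘ valP`).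
[folklore] -/
def placeV (n L : ℕ) (hn : 0 < n) (hL : 0 < L) (M : ℕ → ℕ) (hM : ∀ K, 1 ≤ M K) (s : ℕ → ℕ → ℕ) (cls : Lab d → ℕ) (K ℓ : ℕ)
    (Z : Lab d) : (Fin d → ℕ) × Finset (Pt d) :=
  untypeV (valP n L K (side_pos hn hL K) (levelOf (s K) K) (M K) (hM K) ((ℓ, 0, cls Z) : PEv) Z)

end Data

/-! ## §2 The pedigree reading: the recorded births of the key of record are booked (any `HistReading`) -/

section Reading

variable {d : ℕ} {DomK : ℕ → Type} {I : (K : ℕ) → HIndex (DomK K)} (n L : ℕ) (hn : 0 < n) (hL : 0 < L)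
  (ℛ : HistReading I d)

/-- **THE RECORDED BIRTHS OF THE KEY OF RECORD ARE BOOKED.**  For any history reading `ℛ` and any term `τ`, under the six input
displays of the term's run `ℛ.inputOf.run K τ` (new regions anchored ∕ face-connected ∕ classed — `NewOK`; memory domination `Rm ≤ R`,
its one-step form, non-degenerate memory; disjoint new regions; positive blocking), every recorded birth value of the key family
`kmemA n L hn hL ℛ K τ` at level `ℓ` is the placed value of a region the run books at level `ℓ` (pass V: `mem_N_of_mem_pbirths_pedMV`).
[folklore] -/
theorem birthVals_kmemA_subset_image {K : ℕ} {τ : HIndex.Idx I} (hN : (ℛ.inputOf.run K τ).NewOK)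
    (hRm : ∀ t k, (ℛ.inputOf.run K τ).Rm t k ≤ (ℛ.inputOf.run K τ).R t)
    (hRmS : ∀ t k, (ℛ.inputOf.run K τ).Rm t (k + 1) ≤ (ℛ.inputOf.run K τ).R (t + 1))
    (hRm2 : ∀ t, 2 ≤ (ℛ.inputOf.run K τ).Rm t 1) (hD : (ℛ.inputOf.run K τ).NewDisjoint) (hL0 : 0 < (ℛ.inputOf.run K τ).L)
    (ℓ : ℕ) :
    birthVals (kmemA n L hn hL ℛ K τ) ℓ ⊆
      ((ℛ.inputOf.run K τ).N ℓ).image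
        (placeV n L hn hL (fun K => tcap d (dcapOf Prod.fst (HIndex.termSet I) (memA n L ℛ) K))
          (fun K => one_le_tcap d (dcapOf Prod.fst (HIndex.termSet I) (memA n L ℛ) K)) (runProfile L ℛ.R)
          (ℛ.inputOf.run K τ).cls K ℓ) := by
  intro v hv
  obtain ⟨w, hw, e, hev, he⟩ := mem_birthVals.1 hv
  obtain ⟨c, hc, rfl⟩ := mem_kmemOf.1 hw
  obtain ⟨c₀, hc₀, rfl⟩ := Finset.mem_image.1 hc
  simp only [keyOf, physV, Multiset.mem_map] at hev
  obtain ⟨bz, hbz, hbzeq⟩ := hev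
  obtain ⟨-, hmem, hlab⟩ := RunInputM.mem_N_of_mem_pbirths_pedMV hN hRm hRmS hRm2 hD hL0 hc₀ hbz
  have h1 : bz.1 = e := congrArg Prod.fst hbzeq
  have hstep : bz.1.step = ℓ := by rw [h1, he]
  refine Finset.mem_image.2 ⟨bz.2, ?_, ?_⟩
  · rw [← hstep]
    exact hmem
  · rw [placeV, ← hstep, ← hlab]
    exact congrArg Prod.snd hbzeq

end Reading

/-! ## §3 At the causal step reading: (d3) discharged for the key of record; `pwA` from the step kernel's two displays -/

section Causal

variable {P : Type} [DecidableEq P] {d : ℕ} (𝒮 : StepReading P d) {C : ℕ → ℕ → Type} {𝒢 : (K j : ℕ) → GoodClass (C K j)}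
  (T : (K : ℕ) → Tower P (C K) (𝒢 K)) (p₀ : ℕ → ℕ → P) (n L : ℕ) (hn : 0 < n) (hL : 0 < L)

/-- the class map of a term's run under the causal reading is the run's `𝒮.κ K`. [folklore] -/
theorem cls_run_eq {K : ℕ} {τ : HIndex.Idx (skelFam T p₀)} (hτ : τ ∈ HIndex.termSet (skelFam T p₀) K) :
    ((𝒮.reading T p₀).inputOf.run K τ).cls = 𝒮.κ K := by
  obtain ⟨x, -, rfl⟩ := Finset.mem_map.mp hτ
  rfl

/-- **(d3) OF `KeyPatternBooking.pointwiseExtraction_keyPattern_of_reading` DISCHARGED FOR THE KEY OF RECORD**: under the record's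
input displays at cutoff `K` (`hν` — named regions anchored ∕ face-connected ∕ classed; `hRm`, `hRmS`, `hRm2`; `hD` per term; `0 < 𝒮.L`),
for every term `τ` of the fibre of `k` the recorded birth values `birthVals k (j + 1)` are placed values of regions `τ`'s run books at
level `j + 1`. [folklore] -/
theorem birthVals_subset_image_of_mem_fibre
    (hν : ∀ K j g p, ∀ nr ∈ 𝒮.ν K j g p, nr.1 ∈ nr.2 ∧ FaceConnected nr.2 ∧ treeLen nr.2 ≤ 𝒮.κ K nr) {K : ℕ}
    (hRm : ∀ t k, 𝒮.Rm K t k ≤ 𝒮.R K t) (hRmS : ∀ t k, 𝒮.Rm K t (k + 1) ≤ 𝒮.R K (t + 1)) (hRm2 : ∀ t, 2 ≤ 𝒮.Rm K t 1)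
    (hD : ∀ τ ∈ HIndex.termSet (skelFam T p₀) K, ((𝒮.reading T p₀).inputOf.run K τ).NewDisjoint) (hL0 : 0 < 𝒮.L)
    {k : Finset ((Fin d → ℕ) × Gen PEv × Multiset (PEv × ((Fin d → ℕ) × Finset (Pt d))))} (ℓ : ℕ)
    {τ : HIndex.Idx (skelFam T p₀)}
    (hτ : τ ∈ fibre (kmemA n L hn hL (𝒮.reading T p₀)) (HIndex.termSet (skelFam T p₀)) K k) :
    birthVals k ℓ ⊆ (((𝒮.reading T p₀).inputOf.run K τ).N ℓ).image
      (placeV n L hn hL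
        (fun K => tcap d (dcapOf Prod.fst (HIndex.termSet (skelFam T p₀)) (memA n L (𝒮.reading T p₀)) K))
        (fun K => one_le_tcap d (dcapOf Prod.fst (HIndex.termSet (skelFam T p₀)) (memA n L (𝒮.reading T p₀)) K))
        (runProfile L 𝒮.R) (𝒮.κ K) K ℓ) := by
  obtain ⟨hτT, hkτ⟩ := mem_fibre.1 hτ
  rw [← hkτ, ← cls_run_eq 𝒮 T p₀ hτT]
  exact birthVals_kmemA_subset_image n L hn hL (𝒮.reading T p₀) (𝒮.newOK_run T p₀ hν K τ) hRm hRmS hRm2 (hD τ hτT)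
    hL0 ℓ

/-- **IR-104-2's ROW `pwA` FOR THE KEY FAMILY OF RECORD, FROM THE STEP KERNEL's TWO DISPLAYS.**  At cutoff `K`, for every key `k`,
with the step kernel `χ` of the cutoff-`K` tower: from (d1) `hle1` (the pinned characteristic functions sum to at most one at every
pattern prefix), (d2) `hsupp` — the FIELD-SUPPORT READING THROUGH THE PLACEMENT (wherever `χ j g p y ≠ 0`, for every region `Z` the
choice names, `θ j (placeV … K (j+1) Z) ≤ F j (placeV … K (j+1) Z) y`; [Balaban1989LargeFieldI] (1.22)–(1.28) pp. 181–183 — LOCATOR,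
(A1c)'s to read for its own kernel), and the record's input displays at `K`:
`PointwiseExtraction (T K) (keyPattern T p₀ (kmemA …) K k) K χ M a` with `a j = δ·Σ_{w ∈ birthVals k (j+1)} θ j w` and
`M j y = exp (δ·Σ_{w ∈ birthVals k (j+1)} F j w y)` — NO (d3) binder. [folklore] -/
theorem pointwiseExtraction_keyPattern_kmemA
    (hν : ∀ K j g p, ∀ nr ∈ 𝒮.ν K j g p, nr.1 ∈ nr.2 ∧ FaceConnected nr.2 ∧ treeLen nr.2 ≤ 𝒮.κ K nr) (K : ℕ)
    (hRm : ∀ t k, 𝒮.Rm K t k ≤ 𝒮.R K t) (hRmS : ∀ t k, 𝒮.Rm K t (k + 1) ≤ 𝒮.R K (t + 1)) (hRm2 : ∀ t, 2 ≤ 𝒮.Rm K t 1)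
    (hD : ∀ τ ∈ HIndex.termSet (skelFam T p₀) K, ((𝒮.reading T p₀).inputOf.run K τ).NewDisjoint) (hL0 : 0 < 𝒮.L)
    (k : Finset ((Fin d → ℕ) × Gen PEv × Multiset (PEv × ((Fin d → ℕ) × Finset (Pt d)))))
    (χ : (j : ℕ) → (Fin j → P) → P → C K j → ℝ) (F : (j : ℕ) → (Fin d → ℕ) × Finset (Pt d) → C K j → ℝ)
    (θ : ℕ → (Fin d → ℕ) × Finset (Pt d) → ℝ) {δ : ℝ} (hδ : 0 ≤ δ)
    (hle1 : ∀ j g, j < K → g ∈ admS (T K) (keyPattern T p₀ (kmemA n L hn hL (𝒮.reading T p₀)) K k) j → ∀ y,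
      ∑ p ∈ (T K).branch j g ∩ keyPattern T p₀ (kmemA n L hn hL (𝒮.reading T p₀)) K k j g, χ j g p y ≤ 1)
    (hsupp : ∀ j g p, j < K → g ∈ (T K).adm j → p ∈ (T K).branch j g → ∀ y, χ j g p y ≠ 0 → ∀ Z ∈ 𝒮.ν K j g p,
      θ j (placeV n L hn hL
          (fun K => tcap d (dcapOf Prod.fst (HIndex.termSet (skelFam T p₀)) (memA n L (𝒮.reading T p₀)) K))
          (fun K => one_le_tcap d (dcapOf Prod.fst (HIndex.termSet (skelFam T p₀)) (memA n L (𝒮.reading T p₀)) K))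
          (runProfile L 𝒮.R) (𝒮.κ K) K (j + 1) Z) ≤
        F j (placeV n L hn hL
          (fun K => tcap d (dcapOf Prod.fst (HIndex.termSet (skelFam T p₀)) (memA n L (𝒮.reading T p₀)) K))
          (fun K => one_le_tcap d (dcapOf Prod.fst (HIndex.termSet (skelFam T p₀)) (memA n L (𝒮.reading T p₀)) K))
          (runProfile L 𝒮.R) (𝒮.κ K) K (j + 1) Z) y) :
    PointwiseExtraction (T K) (keyPattern T p₀ (kmemA n L hn hL (𝒮.reading T p₀)) K k) K χ
      (fun j _ y => exp (δ * ∑ w ∈ birthVals k (j + 1), F j w y)) fun j _ => δ * ∑ w ∈ birthVals k (j + 1), θ j w :=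
  pointwiseExtraction_keyPattern_of_reading 𝒮 T p₀ (kmemA n L hn hL (𝒮.reading T p₀))
    (fun ℓ => placeV n L hn hL
      (fun K => tcap d (dcapOf Prod.fst (HIndex.termSet (skelFam T p₀)) (memA n L (𝒮.reading T p₀)) K))
      (fun K => one_le_tcap d (dcapOf Prod.fst (HIndex.termSet (skelFam T p₀)) (memA n L (𝒮.reading T p₀)) K))
      (runProfile L 𝒮.R) (𝒮.κ K) K ℓ)
    K k χ F θ hδ (birthVals k)
    (fun j _ _ hτ => birthVals_subset_image_of_mem_fibre 𝒮 T p₀ n L hn hL hν hRm hRmS hRm2 hD hL0 (j + 1) hτ) hle1 hsupp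

/-- **… FROM POSITIVITY AND THE DECOMPOSITION OF UNITY** ((d1) from `hχ0` + IR-102-1's `hunit`). [folklore] -/
theorem pointwiseExtraction_keyPattern_kmemA_of_unit
    (hν : ∀ K j g p, ∀ nr ∈ 𝒮.ν K j g p, nr.1 ∈ nr.2 ∧ FaceConnected nr.2 ∧ treeLen nr.2 ≤ 𝒮.κ K nr) (K : ℕ)
    (hRm : ∀ t k, 𝒮.Rm K t k ≤ 𝒮.R K t) (hRmS : ∀ t k, 𝒮.Rm K t (k + 1) ≤ 𝒮.R K (t + 1)) (hRm2 : ∀ t, 2 ≤ 𝒮.Rm K t 1)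
    (hD : ∀ τ ∈ HIndex.termSet (skelFam T p₀) K, ((𝒮.reading T p₀).inputOf.run K τ).NewDisjoint) (hL0 : 0 < 𝒮.L)
    (k : Finset ((Fin d → ℕ) × Gen PEv × Multiset (PEv × ((Fin d → ℕ) × Finset (Pt d)))))
    (χ : (j : ℕ) → (Fin j → P) → P → C K j → ℝ) (F : (j : ℕ) → (Fin d → ℕ) × Finset (Pt d) → C K j → ℝ)
    (θ : ℕ → (Fin d → ℕ) × Finset (Pt d) → ℝ) {δ : ℝ} (hδ : 0 ≤ δ)
    (hχ0 : ∀ j g p, j < K → g ∈ (T K).adm j → p ∈ (T K).branch j g → ∀ y, 0 ≤ χ j g p y)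
    (hunit : ∀ j g, j < K → g ∈ (T K).adm j → ∀ y, ∑ p ∈ (T K).branch j g, χ j g p y = 1)
    (hsupp : ∀ j g p, j < K → g ∈ (T K).adm j → p ∈ (T K).branch j g → ∀ y, χ j g p y ≠ 0 → ∀ Z ∈ 𝒮.ν K j g p,
      θ j (placeV n L hn hL
          (fun K => tcap d (dcapOf Prod.fst (HIndex.termSet (skelFam T p₀)) (memA n L (𝒮.reading T p₀)) K))
          (fun K => one_le_tcap d (dcapOf Prod.fst (HIndex.termSet (skelFam T p₀)) (memA n L (𝒮.reading T p₀)) K))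
          (runProfile L 𝒮.R) (𝒮.κ K) K (j + 1) Z) ≤
        F j (placeV n L hn hL
          (fun K => tcap d (dcapOf Prod.fst (HIndex.termSet (skelFam T p₀)) (memA n L (𝒮.reading T p₀)) K))
          (fun K => one_le_tcap d (dcapOf Prod.fst (HIndex.termSet (skelFam T p₀)) (memA n L (𝒮.reading T p₀)) K))
          (runProfile L 𝒮.R) (𝒮.κ K) K (j + 1) Z) y) :
    PointwiseExtraction (T K) (keyPattern T p₀ (kmemA n L hn hL (𝒮.reading T p₀)) K k) K χ
      (fun j _ y => exp (δ * ∑ w ∈ birthVals k (j + 1), F j w y)) fun j _ => δ * ∑ w ∈ birthVals k (j + 1), θ j w :=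
  pointwiseExtraction_keyPattern_kmemA 𝒮 T p₀ n L hn hL hν K hRm hRmS hRm2 hD hL0 k χ F θ hδ
    (fun j g hj hg y => sum_inter_le_one _ _ (fun p => χ j g p) y
      (fun p hp => hχ0 j g p hj (admS_subset_adm (T K) _ j hg) hp y) (hunit j g hj (admS_subset_adm (T K) _ j hg) y))
    hsupp

/-- **… WITH MULTIPLICITY** (the exponent and the carrier's functional summed over the key's recorded births PER MEMBER —
`birthValsM`; `ClassPatternBooking.pointwiseExtraction_classPattern_of_readingM` at `Φ := fibre (kmemA …) … K k`, whose class pattern IS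
the key pattern): `a j = δ·Σ_{w ∈ birthValsM k (j+1)} θ j w`, `M j y = exp (δ·Σ_{w ∈ birthValsM k (j+1)} F j w y)`, from (d1), (d2) and the
record's input displays. [folklore] -/
theorem pointwiseExtraction_keyPattern_kmemA_mult
    (hν : ∀ K j g p, ∀ nr ∈ 𝒮.ν K j g p, nr.1 ∈ nr.2 ∧ FaceConnected nr.2 ∧ treeLen nr.2 ≤ 𝒮.κ K nr) (K : ℕ)
    (hRm : ∀ t k, 𝒮.Rm K t k ≤ 𝒮.R K t) (hRmS : ∀ t k, 𝒮.Rm K t (k + 1) ≤ 𝒮.R K (t + 1)) (hRm2 : ∀ t, 2 ≤ 𝒮.Rm K t 1)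
    (hD : ∀ τ ∈ HIndex.termSet (skelFam T p₀) K, ((𝒮.reading T p₀).inputOf.run K τ).NewDisjoint) (hL0 : 0 < 𝒮.L)
    (k : Finset ((Fin d → ℕ) × Gen PEv × Multiset (PEv × ((Fin d → ℕ) × Finset (Pt d)))))
    (χ : (j : ℕ) → (Fin j → P) → P → C K j → ℝ) (F : (j : ℕ) → (Fin d → ℕ) × Finset (Pt d) → C K j → ℝ)
    (θ : ℕ → (Fin d → ℕ) × Finset (Pt d) → ℝ) {δ : ℝ} (hδ : 0 ≤ δ)
    (hle1 : ∀ j g, j < K → g ∈ admS (T K) (keyPattern T p₀ (kmemA n L hn hL (𝒮.reading T p₀)) K k) j → ∀ y,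
      ∑ p ∈ (T K).branch j g ∩ keyPattern T p₀ (kmemA n L hn hL (𝒮.reading T p₀)) K k j g, χ j g p y ≤ 1)
    (hsupp : ∀ j g p, j < K → g ∈ (T K).adm j → p ∈ (T K).branch j g → ∀ y, χ j g p y ≠ 0 → ∀ Z ∈ 𝒮.ν K j g p,
      θ j (placeV n L hn hL
          (fun K => tcap d (dcapOf Prod.fst (HIndex.termSet (skelFam T p₀)) (memA n L (𝒮.reading T p₀)) K))
          (fun K => one_le_tcap d (dcapOf Prod.fst (HIndex.termSet (skelFam T p₀)) (memA n L (𝒮.reading T p₀)) K))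
          (runProfile L 𝒮.R) (𝒮.κ K) K (j + 1) Z) ≤
        F j (placeV n L hn hL
          (fun K => tcap d (dcapOf Prod.fst (HIndex.termSet (skelFam T p₀)) (memA n L (𝒮.reading T p₀)) K))
          (fun K => one_le_tcap d (dcapOf Prod.fst (HIndex.termSet (skelFam T p₀)) (memA n L (𝒮.reading T p₀)) K))
          (runProfile L 𝒮.R) (𝒮.κ K) K (j + 1) Z) y) :
    PointwiseExtraction (T K) (keyPattern T p₀ (kmemA n L hn hL (𝒮.reading T p₀)) K k) K χ
      (fun j _ y => exp (δ * ((birthValsM k (j + 1)).map fun w => F j w y).sum))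
      fun j _ => δ * ((birthValsM k (j + 1)).map (θ j)).sum :=
  pointwiseExtraction_classPattern_of_readingM 𝒮 T p₀
    (fun ℓ => placeV n L hn hL
      (fun K => tcap d (dcapOf Prod.fst (HIndex.termSet (skelFam T p₀)) (memA n L (𝒮.reading T p₀)) K))
      (fun K => one_le_tcap d (dcapOf Prod.fst (HIndex.termSet (skelFam T p₀)) (memA n L (𝒮.reading T p₀)) K))
      (runProfile L 𝒮.R) (𝒮.κ K) K ℓ)
    K (fibre (kmemA n L hn hL (𝒮.reading T p₀)) (HIndex.termSet (skelFam T p₀)) K k) χ F θ hδ (birthValsM k)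
    (fun j _ _ hτ _ hw => birthVals_subset_image_of_mem_fibre 𝒮 T p₀ n L hn hL hν hRm hRmS hRm2 hD hL0 (j + 1) hτ
      (mem_birthValsM_iff_mem_birthVals.1 hw))
    hle1 hsupp

end Causal

end

end Summit.QuantumFields.BalabanUV.T4Continuum.NE7b.KeyBirthsBooked
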